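import Literature.NumberTheory.GaloisCohomology.Howard2004.ModIdeal
import Mathlib.LinearAlgebra.Isomorphisms
import Mathlib.Algebra.Module.Submodule.Pointwise
import HarnessLib

/-!
# The `π`-adic refinement `… → T/π^{i+1}T → T/π^iT → …` of a `p`-adic tower, as a two-index family of
# presentations (Howard 2004, Def. 1.1.3 / §1.6; definitions with bodies + proved identities; no named fact,
# no instance, no `sorry`)

B. Howard, *The Heegner point Kolyvagin system*, Compositio Math. 140 (2004) (arXiv:1202.6340): the objects of
`Quot(T)` are ALL the quotients `T/IT` (Def. 1.1.3, p. 5 L93–99); for the Eisenstein specialisation `T = T_𝔮`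
over the DVR `S_𝔮 = Λ/(q_m)` (uniformiser `π`, `π^m = -p`) these are the `T/π^iT`, whereas the tree carries `T_𝔮`
as the `p`-adic tower `k ↦ T_𝔮/p^k` (`EisensteinLevel`, `eisensteinAdicTower[Succ]`; level `k` is `T/π^{e_k}`,
`e_k = mk` or `m(k+1)`).  Howard's H.3 at level `k` (cartesian on `Quot(T^{(k)})`) therefore needs the
INTERMEDIATE quotients `T/π^iT`, `i ≤ e_k`, and the maps `×π^{b-a} : T/π^aT → T/π^bT` (`a ≤ b`) and
`T/π^aT ↠ T/π^bT` (`a ≥ b`) between them (D1 memo `HOME/p1/H3-CARTESIAN-PLAN`, remark (2)).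

This file builds them from an abstract **`PiRefinementDatum`** — an `R`-linear `p`-adic tower presented by a
two-index family of surjective reductions `red : N k' ↠ N k` (`k ≤ k'`) with `ker = π^{e_k} · N k'` (level `k` IS
`T/π^{e_k}`), a host function `host` with `i ≤ e (host i)`, and exact `π`-divisibility below the level exponent —
as the two-index family the cell's cohomological machinery consumes (x10b-p1-w7's `TowerLocalH1LiftExactProofs`:
ONE total family `F a b` with the element-level identities `hid/hcomp/hsq/hinj/hsurj/hex/hpow/hkill`):

* `PiRefinementDatum.Level D i = N (host i) ⧸ π^i · N (host i)` (an `abbrev`; instances by unfolding) with the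
  discrete `Γ_K`-action `levelRep D i := modIdeal …` (tree `Howard2004.modIdeal`);
* `PiRefinementDatum.map D a b : Level a →ₗ[R] Level b` — THE SINGLE FORMULA «reduce a lift and multiply by
  `π^{b∸a}`» (truncated subtraction: for `a ≥ b` it is the reduction, for `a ≤ b` it is `×π^{b-a}`), defined through
  the common host `host a + host b`; `mapI D a b` the same as a continuous intertwining map;
* the host-free evaluation **`map_mk_red`**: `map a b [red n]_a = [π^{b∸a} · red n]_b` for `n` on ANY level above
  both hosts — from which: `map_self` (hid), `map_map_of_le` (hcomp), `map_map_succ` (hsq), `map_map_smul` (hpow: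
  `map ℓ (ℓ+n) ∘ map (ℓ+n) ℓ = π^n •`), `pow_smul_level_eq_zero` (hkill), `map_surjective` (hsurj),
  `map_injective` (hinj), `map_eq_zero_iff` (hex), `map_equivariant`, `isScalarLinear_levelRep`;
* `isQuotientBy_levelRep` — `Level i` with `[·]_i ∘ red : N k ↠ Level i` PRESENTS `T^{(k)}/π^i T^{(k)}` for
  `host i ≤ k`, `i ≤ e k` (the object of `Quot(T^{(k)})`, Def. 1.1.3), and `map_mk_red` read at host `k` says
  `map i j` is the `Quot`-morphism `×π^{j-i}` on these presentations.

Cell `pub/bsd-print-x9`, shared μ-item of rows 9/10 (D1 road, `SatisfiesH.h3`); seat `bsd-line-x10b-p1-w6`.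
No statement about elliptic curves or Selmer groups is made; BSD is not proved by any of this.

References: [Howard2004HeegnerKolyvagin] Def. 1.1.3 (arXiv p. 5 L93–99), §1.6 (p. 12 L29–55: the tower
`T/𝔪^k T`), proof of Thm. 2.2.10 (`𝔮 = T^m + p`); [SerreGaloisCohomology1997] I §2.2.
-/

set_option autoImplicit false

noncomputable section

open Function Field
open scoped Classical Pointwise ContRepresentation

namespace Literature.NumberTheory.GaloisCohomology.Howard2004

open Literature.NumberTheory.GaloisRepresentations
open Literature.NumberTheory.GaloisRepresentations.DiscreteGaloisModule

/-! ## §0 Plumbing: descending a linear map along a surjection -/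

section Descend

variable {R : Type} [CommRing R] {P Q X : Type} [AddCommGroup P] [Module R P] [AddCommGroup Q] [Module R Q]
  [AddCommGroup X] [Module R X]

/-- The map `Q → X` induced by `φ : P → X` along a SURJECTION `s : P ↠ Q` whose kernel `φ` kills (first
isomorphism theorem; plumbing for the maps of `Quot(T)`). [cite: Howard2004HeegnerKolyvagin, Def. 1.1.3 (arXiv Def. 2.1.3, p. 5 L95–97: maps induced on quotients)] -/
def descend (s : P →ₗ[R] Q) (hs : Surjective s) (φ : P →ₗ[R] X) (hφ : LinearMap.ker s ≤ LinearMap.ker φ) :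
    Q →ₗ[R] X :=
  ((LinearMap.ker s).liftQ φ hφ).comp (s.quotKerEquivOfSurjective hs).symm.toLinearMap

/-- `descend s hs φ hφ (s p) = φ p` (first isomorphism theorem). [cite: Howard2004HeegnerKolyvagin, Def. 1.1.3 (arXiv Def. 2.1.3, p. 5 L95–97: the maps of Quot(T) are induced through the quotient maps)] -/
@[simp]
theorem descend_apply (s : P →ₗ[R] Q) (hs : Surjective s) (φ : P →ₗ[R] X)
    (hφ : LinearMap.ker s ≤ LinearMap.ker φ) (x : P) : descend s hs φ hφ (s x) = φ x := by
  simp [descend, LinearMap.quotKerEquivOfSurjective_symm_apply]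

end Descend

/-! ## §1 The datum -/

/-- **A `p`-adic tower presented for `π`-adic refinement** (Howard §1.6: `T` over a DVR with uniformiser `π`,
levels `T/𝔪^{e_k}T`; here abstractly): `R`-linear discrete `Γ_K`-modules `N k` with a two-index family of
surjective `R`-linear equivariant reductions `red : N k' → N k` (`k ≤ k'`, functorial), an element `π` and
exponents `e` with `ker (red : N k' → N k) = π^{e_k} · N k'` (so level `k` presents `T/π^{e_k}`), exact
`π`-divisibility below the exponent (`π^n x ∈ π^{c+n} N_k ⇒ x ∈ π^c N_k` for `c + n ≤ e_k`, true for `T` free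
over `R/π^{e_k}`), and a monotone HOST function with `i ≤ e (host i)` (the `p`-adic level carrying `T/π^iT`).
[cite: Howard2004HeegnerKolyvagin, §1.6 (arXiv p. 12 L29–55) and Def. 1.1.3 (p. 5 L93–99)] -/
structure PiRefinementDatum (K : Type) [Field K] (R : Type) [CommRing R] (N : ℕ → Type)
    [∀ k, AddCommGroup (N k)] [∀ k, Module R (N k)] [∀ k, TopologicalSpace (N k)]
    [∀ k, DiscreteTopology (N k)] where
  /-- the Galois action on level `k` -/
  ρ : ∀ k, DiscreteGaloisModule K (N k)
  /-- `R`-linearity of the actions -/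
  hlin : ∀ k, (ρ k).IsScalarLinear R
  /-- the reductions `N k' → N k`, `k ≤ k'` -/
  red : ∀ ⦃k k' : ℕ⦄, k ≤ k' → (N k' →ₗ[R] N k)
  red_equivariant : ∀ ⦃k k' : ℕ⦄ (h : k ≤ k') (σ : absoluteGaloisGroup K) (x : N k'),
    red h (ρ k' σ x) = ρ k σ (red h x)
  red_refl : ∀ (k : ℕ) (x : N k), red (le_refl k) x = x
  red_trans : ∀ ⦃a b c : ℕ⦄ (h₁ : a ≤ b) (h₂ : b ≤ c) (x : N c), red (h₁.trans h₂) x = red h₁ (red h₂ x)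
  red_surjective : ∀ ⦃k k' : ℕ⦄ (h : k ≤ k'), Surjective (red h)
  /-- the uniformiser -/
  π : R
  /-- level `k` is `T/π^{e k}` -/
  e : ℕ → ℕ
  e_mono : Monotone e
  ker_red : ∀ ⦃k k' : ℕ⦄ (h : k ≤ k'),
    LinearMap.ker (red h) = Ideal.span {π ^ e k} • (⊤ : Submodule R (N k'))
  /-- exact divisibility below the exponent -/
  smul_mem_cancel : ∀ (k : ℕ) (x : N k) (c n : ℕ), c + n ≤ e k →
    π ^ n • x ∈ Ideal.span {π ^ (c + n)} • (⊤ : Submodule R (N k)) → x ∈ Ideal.span {π ^ c} • (⊤ : Submodule R (N k))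
  /-- the host of `T/π^iT` -/
  host : ℕ → ℕ
  host_mono : Monotone host
  le_e_host : ∀ i, i ≤ e (host i)

namespace PiRefinementDatum

variable {K : Type} [Field K] {R : Type} [CommRing R] {N : ℕ → Type}
  [∀ k, AddCommGroup (N k)] [∀ k, Module R (N k)] [∀ k, TopologicalSpace (N k)] [∀ k, DiscreteTopology (N k)]
  (D : PiRefinementDatum K R N)

/-! ## §2 The submodules `π^i · N_k`, levels and their presentations -/

/-- `π^i · N_k`. [cite: Howard2004HeegnerKolyvagin, Def. 1.1.3 (arXiv p. 5 L93–99: IT for I = (π^i))] -/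
abbrev piPow (k i : ℕ) : Submodule R (N k) := Ideal.span {D.π ^ i} • ⊤

/-- `π^i · x ∈ π^i · N`. [cite: Howard2004HeegnerKolyvagin, Def. 1.1.3 (arXiv p. 5 L93–99)] -/
theorem pow_smul_mem_piPow (k i : ℕ) (x : N k) : D.π ^ i • x ∈ D.piPow k i :=
  Submodule.smul_mem_smul (Ideal.mem_span_singleton_self _) Submodule.mem_top

/-- `π^a · x ∈ π^i · N` for `i ≤ a`. [cite: Howard2004HeegnerKolyvagin, Def. 1.1.3 (arXiv p. 5 L93–99)] -/
theorem pow_smul_mem_piPow_of_le (k : ℕ) {i a : ℕ} (h : i ≤ a) (x : N k) : D.π ^ a • x ∈ D.piPow k i := by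
  rw [← Nat.sub_add_cancel h, pow_add, mul_smul]
  exact Submodule.smul_mem _ _ (D.pow_smul_mem_piPow k i x)

/-- `π^i · N` decreases in `i`. [cite: Howard2004HeegnerKolyvagin, Def. 1.1.3 (arXiv p. 5 L93–99)] -/
theorem piPow_antitone (k : ℕ) {i a : ℕ} (h : i ≤ a) : D.piPow k a ≤ D.piPow k i :=
  Submodule.smul_mono_left (Ideal.span_singleton_le_span_singleton.mpr (pow_dvd_pow _ h))

/-- Membership in `π^i · N`: `x = π^i · y`. [cite: Howard2004HeegnerKolyvagin, Def. 1.1.3 (arXiv p. 5 L93–99)] -/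
theorem mem_piPow_iff (k i : ℕ) (x : N k) : x ∈ D.piPow k i ↔ ∃ y : N k, D.π ^ i • y = x := by
  rw [piPow, Submodule.ideal_span_singleton_smul, Submodule.mem_smul_pointwise_iff_exists]
  simp

/-- The reductions carry `π^i · N_{k'}` ONTO `π^i · N_k`. [cite: Howard2004HeegnerKolyvagin, §1.6 (arXiv p. 12)] -/
theorem map_red_piPow {k k' : ℕ} (h : k ≤ k') (i : ℕ) : (D.piPow k' i).map (D.red h) = D.piPow k i := by
  rw [piPow, Submodule.map_smul'', Submodule.map_top, LinearMap.range_eq_top.mpr (D.red_surjective h)]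

/-- **Preimage of `π^i · N_k` under a reduction**: `π^i · N_{k'} + π^{e_k} · N_{k'}`, hence `π^i · N_{k'}` when
`i ≤ e_k` (the level `T/π^iT` does not see above `π^{e_k}`). [cite: Howard2004HeegnerKolyvagin, §1.6 (arXiv p. 12 L29–55)] -/
theorem comap_red_piPow {k k' : ℕ} (h : k ≤ k') {i : ℕ} (hi : i ≤ D.e k) :
    (D.piPow k i).comap (D.red h) = D.piPow k' i := by
  rw [← D.map_red_piPow h i, Submodule.comap_map_eq, D.ker_red h]
  exact sup_eq_left.mpr (D.piPow_antitone k' hi)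

/-- **Level `i` of the `π`-adic refinement**: `T/π^iT` presented on its host, `N (host i) ⧸ π^i · N (host i)`
(an `abbrev`: group, `R`-module and discrete-topology instances are those of the quotient).
[cite: Howard2004HeegnerKolyvagin, Def. 1.1.3 and §1.6 (arXiv p. 5 L93–99, p. 12 L29–55)] -/
abbrev Level (i : ℕ) : Type := N (D.host i) ⧸ D.piPow (D.host i) i

/-- The `Γ_K`-action on `Level i` (tree `modIdeal`). [cite: Howard2004HeegnerKolyvagin, Def. 1.1.3 (arXiv p. 5 L93–99)] -/
def levelRep (i : ℕ) : DiscreteGaloisModule K (D.Level i) :=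
  modIdeal (D.ρ (D.host i)) (D.hlin _) (Ideal.span {D.π ^ i})

/-- Unfolding the action on classes. [cite: Howard2004HeegnerKolyvagin, Def. 1.1.3 (arXiv p. 5 L93–99)] -/
@[simp]
theorem levelRep_apply_mk (i : ℕ) (σ : absoluteGaloisGroup K) (x : N (D.host i)) :
    D.levelRep i σ (Submodule.Quotient.mk x) = Submodule.Quotient.mk (D.ρ (D.host i) σ x) :=
  rfl

/-- The action on `Level i` is `R`-linear. [cite: Howard2004HeegnerKolyvagin, Def. 1.1.3 (arXiv p. 5 L93–99)] -/
theorem isScalarLinear_levelRep (i : ℕ) : (D.levelRep i).IsScalarLinear R :=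
  isScalarLinear_modIdeal _ _ _

/-- **The presentation of `T^{(k)}/π^i T^{(k)}` by `Level i`**: `[·]_i ∘ red : N k ↠ Level i`, for any level `k`
above the host. [cite: Howard2004HeegnerKolyvagin, Def. 1.1.3 (arXiv p. 5 L93–99)] -/
abbrev proj {i k : ℕ} (h : D.host i ≤ k) : N k →ₗ[R] D.Level i :=
  (D.piPow (D.host i) i).mkQ.comp (D.red h)

/-- `proj` on elements. [cite: Howard2004HeegnerKolyvagin, Def. 1.1.3 (arXiv p. 5 L93–99)] -/
theorem proj_apply {i k : ℕ} (h : D.host i ≤ k) (x : N k) :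
    D.proj h x = Submodule.Quotient.mk (D.red h x) :=
  rfl

/-- `proj` is onto. [cite: Howard2004HeegnerKolyvagin, Def. 1.1.3 (arXiv p. 5 L93–99)] -/
theorem proj_surjective {i k : ℕ} (h : D.host i ≤ k) : Surjective (D.proj h) :=
  (Submodule.mkQ_surjective _).comp (D.red_surjective h)

/-- `ker proj = π^i · N_k` (for any level `k` above the host: `e_k ≥ e_{host i} ≥ i`).
[cite: Howard2004HeegnerKolyvagin, Def. 1.1.3 (arXiv p. 5 L93–99)] -/
theorem ker_proj {i k : ℕ} (h : D.host i ≤ k) : LinearMap.ker (D.proj h) = D.piPow k i := by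
  rw [proj, LinearMap.ker_comp, Submodule.ker_mkQ, D.comap_red_piPow h (D.le_e_host i)]

/-- `proj` along two levels: `proj_{k'} = proj_k ∘ red`. [cite: Howard2004HeegnerKolyvagin, §1.6 (arXiv p. 12)] -/
theorem proj_red {i k k' : ℕ} (h : D.host i ≤ k) (h' : k ≤ k') (x : N k') :
    D.proj h (D.red h' x) = D.proj (h.trans h') x := by
  rw [proj_apply, proj_apply, ← D.red_trans]

/-- **`(Level i, proj)` presents the object `T^{(k)}/π^i T^{(k)}` of `Quot(T^{(k)})`** (Def. 1.1.3) over `R`, for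
every level `k` above the host of `i`. [cite: Howard2004HeegnerKolyvagin, Def. 1.1.3 (arXiv Def. 2.1.3, p. 5 L93–99)] -/
theorem isQuotientBy_levelRep [NumberField K] {i k : ℕ} (h : D.host i ≤ k) :
    IsQuotientBy (D.ρ k) (Ideal.span {D.π ^ i}) (D.levelRep i) (D.proj h) where
  surjective := D.proj_surjective h
  ker_eq := D.ker_proj h
  equivariant σ x := by
    rw [proj_apply, proj_apply, D.red_equivariant, levelRep_apply_mk]

/-! ## §3 The two-index family `map a b` -/

/-- The common host used to define `map a b`. [cite: Howard2004HeegnerKolyvagin, §1.6 (arXiv p. 12)] -/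
theorem host_le_add_left (a b : ℕ) : D.host a ≤ D.host a + D.host b := Nat.le_add_right _ _

/-- The common host used to define `map a b`. [cite: Howard2004HeegnerKolyvagin, §1.6 (arXiv p. 12)] -/
theorem host_le_add_right (a b : ℕ) : D.host b ≤ D.host a + D.host b := Nat.le_add_left _ _

/-- The numerator of `map a b` on the common host: `n ↦ [π^{b∸a} · red n]_b`.
[cite: Howard2004HeegnerKolyvagin, Def. 1.1.3 (arXiv p. 5 L95–97: maps induced by scalars)] -/
abbrev mapNum (a b : ℕ) {H : ℕ} (hb : D.host b ≤ H) : N H →ₗ[R] D.Level b :=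
  (D.proj hb).comp (D.π ^ (b - a) • LinearMap.id)

/-- The numerator on elements: `mapNum a b n = [π^{b∸a} · red n]_b`.
[cite: Howard2004HeegnerKolyvagin, Def. 1.1.3 (arXiv p. 5 L95–97)] -/
theorem mapNum_apply (a b : ℕ) {H : ℕ} (hb : D.host b ≤ H) (n : N H) :
    D.mapNum a b hb n = Submodule.Quotient.mk (D.π ^ (b - a) • D.red hb n) := by
  rw [LinearMap.comp_apply, LinearMap.smul_apply, LinearMap.id_apply, map_smul, proj_apply,
    Submodule.Quotient.mk_smul]

/-- The numerator kills `ker proj_a` (so `map a b` is well defined): `π^{b∸a} · π^a ∈ (π^b)`.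
[cite: Howard2004HeegnerKolyvagin, Def. 1.1.3 (arXiv p. 5 L95–97: rI ⊂ J)] -/
theorem ker_proj_le_ker_mapNum (a b : ℕ) {H : ℕ} (ha : D.host a ≤ H) (hb : D.host b ≤ H) :
    LinearMap.ker (D.proj ha) ≤ LinearMap.ker (D.mapNum a b hb) := by
  rw [D.ker_proj ha]
  intro x hx
  obtain ⟨y, rfl⟩ := (D.mem_piPow_iff H a x).mp hx
  rw [LinearMap.mem_ker, mapNum_apply, map_smul, ← mul_smul, ← pow_add, Submodule.Quotient.mk_eq_zero]
  exact D.pow_smul_mem_piPow_of_le _ (by omega) _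

/-- **The map `T/π^aT → T/π^bT` of the refinement** — ONE formula for all `a`, `b`: lift to the common host,
multiply by `π^{b∸a}`, reduce (`a ≥ b`: the reduction `T/π^aT ↠ T/π^bT`; `a ≤ b`: the injective `Quot`-morphism
`×π^{b-a}`). [cite: Howard2004HeegnerKolyvagin, Def. 1.1.3 (arXiv Def. 2.1.3, p. 5 L93–99)] -/
def map (a b : ℕ) : D.Level a →ₗ[R] D.Level b :=
  descend (D.proj (D.host_le_add_left a b)) (D.proj_surjective _) (D.mapNum a b (D.host_le_add_right a b))
    (D.ker_proj_le_ker_mapNum a b _ _)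

/-- **Host-free evaluation of `map a b`**: for `n` on ANY level `H` above both hosts,
`map a b [red n]_a = [π^{b∸a} · red n]_b`. [cite: Howard2004HeegnerKolyvagin, Def. 1.1.3 (arXiv p. 5 L95–97)] -/
theorem map_mk_red (a b : ℕ) {H : ℕ} (ha : D.host a ≤ H) (hb : D.host b ≤ H) (n : N H) :
    D.map a b (Submodule.Quotient.mk (D.red ha n)) = Submodule.Quotient.mk (D.π ^ (b - a) • D.red hb n) := by
  -- move `n` to the common level `H₀ + H`, `H₀ := host a + host b`
  set H₀ := D.host a + D.host b with hH₀
  obtain ⟨n', rfl⟩ := D.red_surjective (Nat.le_add_left H H₀) n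
  have e1 : D.red ha (D.red (Nat.le_add_left H H₀) n') =
      D.red (D.host_le_add_left a b) (D.red (Nat.le_add_right H₀ H) n') := by
    rw [← D.red_trans, ← D.red_trans]
  have e2 : D.red hb (D.red (Nat.le_add_left H H₀) n') =
      D.red (D.host_le_add_right a b) (D.red (Nat.le_add_right H₀ H) n') := by
    rw [← D.red_trans, ← D.red_trans]
  rw [e1, e2, ← proj_apply, map, descend_apply, mapNum_apply]

/-- `map a b` on the presentations from a level `k` above both hosts: `map a b ∘ proj_a = π^{b∸a} · proj_b`.
[cite: Howard2004HeegnerKolyvagin, Def. 1.1.3 (arXiv p. 5 L95–97)] -/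
theorem map_proj (a b : ℕ) {k : ℕ} (ha : D.host a ≤ k) (hb : D.host b ≤ k) (n : N k) :
    D.map a b (D.proj ha n) = D.π ^ (b - a) • D.proj hb n := by
  rw [proj_apply, map_mk_red, proj_apply, Submodule.Quotient.mk_smul]

/-- (hid) `map a a = id`. [cite: Howard2004HeegnerKolyvagin, Def. 1.1.3 (arXiv p. 5 L93–99)] -/
theorem map_self (a : ℕ) (x : D.Level a) : D.map a a x = x := by
  obtain ⟨n, rfl⟩ := D.proj_surjective (le_refl (D.host a)) x
  rw [map_proj, Nat.sub_self, pow_zero, one_smul]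

/-- (hcomp) For `c ≤ b ≤ a` the reductions compose: `map b c ∘ map a b = map a c`.
[cite: Howard2004HeegnerKolyvagin, Def. 1.1.3 (arXiv p. 5 L93–99)] -/
theorem map_map_of_le {a b c : ℕ} (hcb : c ≤ b) (hba : b ≤ a) (x : D.Level a) :
    D.map b c (D.map a b x) = D.map a c x := by
  obtain ⟨n, rfl⟩ := D.proj_surjective (le_refl (D.host a)) x
  rw [D.map_proj a b le_rfl (D.host_mono hba), Nat.sub_eq_zero_of_le hba, pow_zero, one_smul,
    D.map_proj b c (D.host_mono hba) (D.host_mono (hcb.trans hba)), Nat.sub_eq_zero_of_le hcb,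
    D.map_proj a c le_rfl (D.host_mono (hcb.trans hba)), Nat.sub_eq_zero_of_le (hcb.trans hba)]

/-- (hsq) For `a ≤ b`, `×π^{b-a}` commutes with one reduction step:
`map a b ∘ map (a+1) a = map (b+1) b ∘ map (a+1) (b+1)`. [cite: Howard2004HeegnerKolyvagin, Def. 1.1.3 (arXiv p. 5 L93–99)] -/
theorem map_map_succ {a b : ℕ} (hab : a ≤ b) (w : D.Level (a + 1)) :
    D.map a b (D.map (a + 1) a w) = D.map (b + 1) b (D.map (a + 1) (b + 1) w) := by
  have h1 : D.host (a + 1) ≤ D.host (b + 1) := D.host_mono (by omega)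
  have ha : D.host a ≤ D.host (b + 1) := D.host_mono (by omega)
  have hb : D.host b ≤ D.host (b + 1) := D.host_mono (by omega)
  obtain ⟨n, rfl⟩ := D.proj_surjective h1 w
  rw [D.map_proj (a + 1) a h1 ha, show a - (a + 1) = 0 by omega, pow_zero, one_smul, D.map_proj a b ha hb,
    D.map_proj (a + 1) (b + 1) h1 le_rfl, map_smul, D.map_proj (b + 1) b le_rfl hb,
    show b - (b + 1) = 0 by omega, pow_zero, one_smul, show b + 1 - (a + 1) = b - a by omega]

/-- (hpow) `map ℓ (ℓ+n) ∘ map (ℓ+n) ℓ = π^n •` on `Level (ℓ+n)` (the composite `T/π^{ℓ+n} ↠ T/π^ℓ ↪ T/π^{ℓ+n}`).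
[cite: Howard2004HeegnerKolyvagin, Def. 1.1.3 (arXiv p. 5 L93–99)] -/
theorem map_map_smul (ℓ n : ℕ) (w : D.Level (ℓ + n)) :
    D.map ℓ (ℓ + n) (D.map (ℓ + n) ℓ w) = D.π ^ n • w := by
  have hℓ : D.host ℓ ≤ D.host (ℓ + n) := D.host_mono (Nat.le_add_right ℓ n)
  obtain ⟨x, rfl⟩ := D.proj_surjective (le_refl (D.host (ℓ + n))) w
  rw [D.map_proj (ℓ + n) ℓ le_rfl hℓ, show ℓ - (ℓ + n) = 0 by omega, pow_zero, one_smul,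
    D.map_proj ℓ (ℓ + n) hℓ le_rfl, Nat.add_sub_cancel_left]

/-- (hkill) `π^j` kills `Level j`. [cite: Howard2004HeegnerKolyvagin, Def. 1.1.3 (arXiv p. 5 L93–99)] -/
theorem pow_smul_level_eq_zero (j : ℕ) (w : D.Level j) : D.π ^ j • w = 0 := by
  obtain ⟨x, rfl⟩ := Submodule.mkQ_surjective _ w
  rw [Submodule.mkQ_apply, ← Submodule.Quotient.mk_smul, Submodule.Quotient.mk_eq_zero]
  exact D.pow_smul_mem_piPow _ j x

/-- (hsurj) The reductions `map (ℓ+n) n` are onto. [cite: Howard2004HeegnerKolyvagin, Def. 1.1.3 (arXiv p. 5 L93–99)] -/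
theorem map_surjective (ℓ n : ℕ) : Surjective (D.map (ℓ + n) n) := by
  intro y
  have hn : D.host n ≤ D.host (ℓ + n) := D.host_mono (Nat.le_add_left n ℓ)
  obtain ⟨x, rfl⟩ := D.proj_surjective hn y
  refine ⟨D.proj le_rfl x, ?_⟩
  rw [D.map_proj (ℓ + n) n le_rfl hn, show n - (ℓ + n) = 0 by omega, pow_zero, one_smul]

/-- (hinj) The maps `×π^n : T/π^ℓ → T/π^{ℓ+n}` are injective (exact divisibility below the exponent).
[cite: Howard2004HeegnerKolyvagin, Def. 1.1.2–1.1.3 (arXiv p. 5 L88–99: injective morphisms of Quot(T))] -/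
theorem map_injective (ℓ n : ℕ) : Injective (D.map ℓ (ℓ + n)) := by
  have hℓ : D.host ℓ ≤ D.host (ℓ + n) := D.host_mono (Nat.le_add_right ℓ n)
  intro w₁ w₂ h
  rw [← sub_eq_zero] at h ⊢
  rw [← map_sub] at h
  obtain ⟨x, hx⟩ := D.proj_surjective hℓ (w₁ - w₂)
  rw [← hx] at h ⊢
  rw [D.map_proj ℓ (ℓ + n) hℓ le_rfl, Nat.add_sub_cancel_left, proj_apply, D.red_refl,
    ← Submodule.Quotient.mk_smul, Submodule.Quotient.mk_eq_zero] at h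
  -- `π^n x ∈ π^(ℓ+n) N` ⇒ `x ∈ π^ℓ N`
  have hx' : x ∈ D.piPow (D.host (ℓ + n)) ℓ :=
    D.smul_mem_cancel _ x ℓ n (D.le_e_host (ℓ + n)) h
  rw [proj_apply, Submodule.Quotient.mk_eq_zero, ← D.map_red_piPow hℓ ℓ]
  exact Submodule.mem_map_of_mem hx'

/-- (hex) Exactness of `0 → T/π^ℓ →(×π^n) T/π^{ℓ+n} → T/π^n → 0` in the middle: a class of `T/π^{ℓ+n}` dies in
`T/π^n` iff it is `π^n` times a class of `T/π^ℓ`. [cite: Howard2004HeegnerKolyvagin, Def. 1.1.3 and §1.6 (arXiv p. 5 L93–99, p. 12 L29–55)] -/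
theorem map_eq_zero_iff (ℓ n : ℕ) (y : D.Level (ℓ + n)) :
    D.map (ℓ + n) n y = 0 ↔ ∃ x : D.Level ℓ, D.map ℓ (ℓ + n) x = y := by
  have hℓ : D.host ℓ ≤ D.host (ℓ + n) := D.host_mono (Nat.le_add_right ℓ n)
  have hn : D.host n ≤ D.host (ℓ + n) := D.host_mono (Nat.le_add_left n ℓ)
  constructor
  · intro h
    obtain ⟨z, rfl⟩ := D.proj_surjective (le_refl (D.host (ℓ + n))) y
    rw [D.map_proj (ℓ + n) n le_rfl hn, show n - (ℓ + n) = 0 by omega, pow_zero, one_smul, proj_apply,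
      Submodule.Quotient.mk_eq_zero, ← Submodule.mem_comap, D.comap_red_piPow hn (D.le_e_host n)] at h
    obtain ⟨z₀, rfl⟩ := (D.mem_piPow_iff _ n z).mp h
    refine ⟨D.proj hℓ z₀, ?_⟩
    rw [D.map_proj ℓ (ℓ + n) hℓ le_rfl, Nat.add_sub_cancel_left, ← map_smul]
  · rintro ⟨x, rfl⟩
    obtain ⟨z, rfl⟩ := D.proj_surjective hℓ x
    rw [D.map_proj ℓ (ℓ + n) hℓ le_rfl, Nat.add_sub_cancel_left, ← map_smul,
      D.map_proj (ℓ + n) n le_rfl hn, show n - (ℓ + n) = 0 by omega, pow_zero, one_smul, proj_apply,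
      Submodule.Quotient.mk_eq_zero, map_smul]
    exact D.pow_smul_mem_piPow _ n _

/-- `map a b` is `Γ_K`-equivariant. [cite: Howard2004HeegnerKolyvagin, Def. 1.1.3 (arXiv p. 5 L93–99)] -/
theorem map_equivariant (a b : ℕ) (σ : absoluteGaloisGroup K) (x : D.Level a) :
    D.map a b (D.levelRep a σ x) = D.levelRep b σ (D.map a b x) := by
  have ha := D.host_le_add_left a b
  have hb := D.host_le_add_right a b
  obtain ⟨n, rfl⟩ := D.proj_surjective ha x
  rw [proj_apply, levelRep_apply_mk, ← D.red_equivariant, map_mk_red _ _ _ ha hb, map_mk_red _ _ _ ha hb,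
    levelRep_apply_mk, D.red_equivariant, (D.hlin (D.host b)) σ]

/-- **`map a b` as a continuous intertwining map** (the shape `F a b : (ρ a) →ⁱL (ρ b)` the cell's `H¹` machinery
consumes). [cite: Howard2004HeegnerKolyvagin, Def. 1.1.3 (arXiv p. 5 L93–99)] [cite: SerreGaloisCohomology1997, Ch. I §2.2] -/
def mapI (a b : ℕ) : (D.levelRep a).toContRepresentation →ⁱL (D.levelRep b).toContRepresentation where
  toContinuousLinearMap := ⟨(D.map a b).toAddMonoidHom.toIntLinearMap, continuous_of_discreteTopology⟩
  isIntertwining' σ := by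
    ext x
    exact D.map_equivariant a b σ x

/-- `mapI` is `map` on elements. [cite: Howard2004HeegnerKolyvagin, Def. 1.1.3 (arXiv p. 5 L93–99)] -/
@[simp]
theorem mapI_apply (a b : ℕ) (x : D.Level a) : D.mapI a b x = D.map a b x := rfl

end PiRefinementDatum

end Literature.NumberTheory.GaloisCohomology.Howard2004

end
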